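import Literature.AlgebraicGeometry.Motives.FiniteQuotientBaseChange
import Literature.AlgebraicGeometry.RelativeSpec.GeometricQuotientRecognition
import Literature.AlgebraicGeometry.Morphisms.QuasiFiniteOpenRegularFlat
import Literature.AlgebraicGeometry.Motives.VarietiesRegularProofs
import HarnessLib

/-!
# The quotient map `X → X/Δ` of a smooth projective scheme by a finite group is flat when `X/Δ` is smooth
# (miracle flatness; Mumford AV §7; package P1 of the Albanese-trace line)

Topic `Literature/AlgebraicGeometry/Motives`; namespace `Literature.AlgebraicGeometry.Motives`.  THEOREMS ONLY.
Cell hodgecm-mathlib, fan B, row VI-5 `AlbaneseTraceOfFiniteQuotient` (T) (`Liu2021/AppendixC/AlbaneseFiniteQuotientTrace`),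
package P1 of the director's RULING (T) (ii): «X → X/Δ finite locally free / miracle flatness».  In the binders of
(T) — `k` a field, `X`, `Y` smooth projective `k`-schemes, `act : Δ →* Aut X` a finite group of `k`-automorphisms,
`p : X ⟶ Y` a quotient for separated test objects (`Motives.IsSepQuotient`) — the underlying morphism of schemes
`p.left` is FLAT (and finite, surjective):

* `flat_finiteQuotient_mk_left` — Mumford's quotient map `π : X ⟶ X/Δ` (`Motives.finiteQuotient.mk`) is flat as soon
  as the stalks of `X` and of `X/Δ` are regular local rings: `π` is finite (`finiteQuotient.isFinite_mk_left`) and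
  OPEN (it is a geometric quotient, `RelativeSpec.ActionOver.isGeometricQuotient_gluedMk`), so
  `Morphisms.Flat.of_isOpenMap_of_locallyQuasiFinite` (Matsumura 23.1 stalkwise) applies.
* `flat_left_of_isSepQuotient` — the (T)-shaped statement: by uniqueness of categorical quotients `Y ≅ X/Δ` under
  `X` (the argument of `isoFiniteQuotient_of_isSepQuotient`, here for `Δ` in any universe), smooth `k`-schemes have
  regular stalks (`Motives.isRegularLocalRing_stalk_of_smoothOfRelativeDimension`), and flatness is transported along the iso.
  Also `isFinite_left_of_isSepQuotient`, `surjective_left_of_isSepQuotient`.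

HC_CM is proved only modulo the 7 printed citations until rung 0 closes; this is groundwork for the later rung that
discharges (T) (P2 `∇` of a quotient, P3 cocycle).

## References
* [MumfordAV1970] D. Mumford, *Abelian Varieties* (1970), §7 Thm. p. 66 and Remark; §12.
* [Matsumura1987] H. Matsumura, *Commutative Ring Theory*, Thm. 23.1.
-/

noncomputable section

open CategoryTheory AlgebraicGeometry
open Literature.AlgebraicGeometry.RelativeSpec

universe u v

namespace Literature.AlgebraicGeometry.Motives

variable {k : Type u} [Field k] {Δ : Type v} [Group Δ] [Finite Δ] {X Y : SchemeOver k}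

/-- **Mumford's quotient map `π : X ⟶ X/Δ` is flat when `X` and `X/Δ` have regular stalks** (`X` of finite type
and separated over `k`, Mumford's covering hypothesis `hcov`): `π` is finite and open (a geometric quotient), so the
stalkwise miracle flatness `Morphisms.Flat.of_isOpenMap_of_locallyQuasiFinite` applies.
[cite: MumfordAV1970, §7 Thm. p. 66; §12] [cite: Matsumura1987, Thm. 23.1] -/
theorem flat_finiteQuotient_mk_left (ρ : ActionOver X.hom Δ) [IsSeparated X.hom] [LocallyOfFiniteType X.hom]
    (hcov : ∀ x : X.left, ∃ O : ρ.StableAffineOpens, x ∈ O.1)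
    (hX : ∀ x : X.left, IsRegularLocalRing (X.left.presheaf.stalk x))
    (hQ : ∀ y : (finiteQuotient ρ).left, IsRegularLocalRing ((finiteQuotient ρ).left.presheaf.stalk y)) :
    Flat (finiteQuotient.mk ρ hcov).left := by
  haveI : IsLocallyNoetherian X.left := LocallyOfFiniteType.isLocallyNoetherian X.hom
  haveI : IsFinite (finiteQuotient.mk ρ hcov).left := finiteQuotient.isFinite_mk_left ρ hcov
  have hopen : IsOpenMap (finiteQuotient.mk ρ hcov).left.base := (ρ.isGeometricQuotient_gluedMk hcov).isOpenMap
  exact Morphisms.Flat.of_isOpenMap_of_locallyQuasiFinite _ hopen hX fun x => hQ _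

/-- **Uniqueness of the separated quotient, `Δ` in any universe** (`isoFiniteQuotient_of_isSepQuotient` verbatim
but for `Δ : Type v`): a quotient `p : X ⟶ Y` of a projective `X` for separated test objects with `Y` separated is
Mumford's `X/Δ` under `X`. [cite: MumfordAV1970, §7 Thm. p. 66 (Remark)] -/
theorem isoFiniteQuotient_of_isSepQuotient' (hX : IsProjectiveOver X) (act : Δ →* Aut X) (p : X ⟶ Y)
    (hY : IsSeparated Y.hom) (hq : IsSepQuotient (fun g => act g) p) :
    letI : IsSeparated X.hom := by haveI := hX.isProper; infer_instance
    ∃ i : Y ≅ finiteQuotient (⟨((Over.forget _).mapAut X).comp act, fun g => Over.w (act g).hom⟩ :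
        ActionOver X.hom Δ),
      p ≫ i.hom = finiteQuotient.mk _
        (ActionOver.forall_exists_stableAffineOpen_of_isProjectiveOver _ hX) := by
  haveI : IsSeparated X.hom := by haveI := hX.isProper; infer_instance
  let ρ : ActionOver X.hom Δ := ⟨((Over.forget _).mapAut X).comp act, fun g => Over.w (act g).hom⟩
  have hcov := ActionOver.forall_exists_stableAffineOpen_of_isProjectiveOver ρ hX
  have hov : ∀ g : Δ, (ρ.overIso g).hom = (act g).hom := fun g => Over.OverMorphism.ext rfl
  have hπ : ∀ g : Δ, (act g).hom ≫ finiteQuotient.mk ρ hcov = finiteQuotient.mk ρ hcov := fun g => by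
    rw [← hov]; exact finiteQuotient.overIso_hom_mk ρ hcov g
  have hp : ∀ g : Δ, (ρ.overIso g).hom ≫ p = p := fun g => by rw [hov]; exact hq.hom_comp g
  haveI : Y.left.IsSeparated := ⟨by rw [← Limits.terminal.comp_from Y.hom]; infer_instance⟩
  haveI : (finiteQuotient ρ).left.IsSeparated := by
    haveI := isSeparated_finiteQuotient_hom ρ hcov
    exact ⟨by rw [← Limits.terminal.comp_from (finiteQuotient ρ).hom]; infer_instance⟩
  obtain ⟨a, ha, -⟩ := hq.existsUnique (finiteQuotient.mk ρ hcov) (isSeparated_finiteQuotient_hom ρ hcov) hπ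
  let b : finiteQuotient ρ ⟶ Y := finiteQuotient.desc ρ hcov p hp
  have hab : a ≫ b = 𝟙 Y := hq.hom_ext hY (by rw [reassoc_of% ha, finiteQuotient.mk_desc, Category.comp_id])
  have hba : b ≫ a = 𝟙 _ := by
    rw [finiteQuotient.desc_unique ρ hcov (finiteQuotient.mk ρ hcov) hπ (b ≫ a)
        (by rw [← Category.assoc, finiteQuotient.mk_desc, ha]),
      finiteQuotient.desc_unique ρ hcov (finiteQuotient.mk ρ hcov) hπ (𝟙 _) (Category.comp_id _)]
  exact ⟨⟨a, b, hab, hba⟩, ha⟩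

/-- **The quotient map of (T) is flat**: for `k` a field, `X` and `Y` smooth projective `k`-schemes, a finite group
`act : Δ →* Aut X` of `k`-automorphisms and a quotient `p : X ⟶ Y` for separated test objects
(`Motives.IsSepQuotient`), the morphism of schemes `p.left : X → Y` is FLAT — `Y ≅ X/Δ` under `X`, the stalks of
`X` and `Y` are regular, and `flat_finiteQuotient_mk_left` (miracle flatness).  Package P1 of row VI-5
(`AlbaneseTraceOfFiniteQuotient`). [cite: MumfordAV1970, §7 Thm. p. 66; §12] [cite: Matsumura1987, Thm. 23.1] -/
theorem flat_left_of_isSepQuotient {dX dY : ℕ} (hX : IsProjectiveOver X) (hY : IsProjectiveOver Y)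
    [SmoothOfRelativeDimension dX X.hom] [SmoothOfRelativeDimension dY Y.hom]
    (act : Δ →* Aut X) (p : X ⟶ Y) (hq : IsSepQuotient (fun g => act g) p) : Flat p.left := by
  haveI : IsProper X.hom := hX.isProper
  haveI : IsProper Y.hom := hY.isProper
  haveI : IsSeparated X.hom := inferInstance
  have hYsep : IsSeparated Y.hom := inferInstance
  haveI : Smooth X.hom := SmoothOfRelativeDimension.smooth dX X.hom
  have hXreg : ∀ x : X.left, IsRegularLocalRing (X.left.presheaf.stalk x) :=
    isRegularLocalRing_stalk_of_smoothOfRelativeDimension X.hom dX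
  have hYreg : ∀ y : Y.left, IsRegularLocalRing (Y.left.presheaf.stalk y) :=
    isRegularLocalRing_stalk_of_smoothOfRelativeDimension Y.hom dY
  -- `Y ≅ X/Δ` under `X`
  let ρ : ActionOver X.hom Δ := ⟨((Over.forget _).mapAut X).comp act, fun g => Over.w (act g).hom⟩
  have hcov := ActionOver.forall_exists_stableAffineOpen_of_isProjectiveOver ρ hX
  obtain ⟨i, hi⟩ : ∃ i : Y ≅ finiteQuotient ρ, p ≫ i.hom = finiteQuotient.mk ρ hcov :=
    isoFiniteQuotient_of_isSepQuotient' hX act p hYsep hq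
  -- the stalks of `X/Δ` are regular: transport along `i⁻¹ : X/Δ ≅ Y`
  haveI : IsIso i.inv.left := by
    change IsIso ((Over.forget _).map i.inv)
    infer_instance
  have hQreg : ∀ y : (finiteQuotient ρ).left, IsRegularLocalRing ((finiteQuotient ρ).left.presheaf.stalk y) :=
    fun y =>
      haveI := hYreg (i.inv.left.base y)
      IsRegularLocalRing.of_ringEquiv (asIso (i.inv.left.stalkMap y)).commRingCatIsoToRingEquiv
  -- flatness of `π : X ⟶ X/Δ`, then of `p = π ≫ i⁻¹`
  haveI hπ : Flat (finiteQuotient.mk ρ hcov).left := flat_finiteQuotient_mk_left ρ hcov hXreg hQreg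
  have hp : p = finiteQuotient.mk ρ hcov ≫ i.inv := (Iso.eq_comp_inv i).mpr hi
  rw [hp, Over.comp_left]
  infer_instance

/-- In the situation of (T), `p.left` is finite. [cite: MumfordAV1970, §7 Thm. p. 66] -/
theorem isFinite_left_of_isSepQuotient (hX : IsProjectiveOver X) (hY' : IsSeparated Y.hom)
    [LocallyOfFiniteType X.hom] (act : Δ →* Aut X) (p : X ⟶ Y) (hq : IsSepQuotient (fun g => act g) p) :
    IsFinite p.left := by
  haveI : IsProper X.hom := hX.isProper
  haveI : IsSeparated X.hom := inferInstance
  let ρ : ActionOver X.hom Δ := ⟨((Over.forget _).mapAut X).comp act, fun g => Over.w (act g).hom⟩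
  have hcov := ActionOver.forall_exists_stableAffineOpen_of_isProjectiveOver ρ hX
  obtain ⟨i, hi⟩ : ∃ i : Y ≅ finiteQuotient ρ, p ≫ i.hom = finiteQuotient.mk ρ hcov :=
    isoFiniteQuotient_of_isSepQuotient' hX act p hY' hq
  haveI : IsIso i.inv.left := by
    change IsIso ((Over.forget _).map i.inv)
    infer_instance
  haveI : IsFinite (finiteQuotient.mk ρ hcov).left := finiteQuotient.isFinite_mk_left ρ hcov
  have hp : p = finiteQuotient.mk ρ hcov ≫ i.inv := (Iso.eq_comp_inv i).mpr hi
  rw [hp, Over.comp_left]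
  infer_instance

/-- In the situation of (T), `p.left` is surjective. [cite: MumfordAV1970, §7 Thm. p. 66 (1)] -/
theorem surjective_left_of_isSepQuotient (hX : IsProjectiveOver X) (hY' : IsSeparated Y.hom)
    (act : Δ →* Aut X) (p : X ⟶ Y) (hq : IsSepQuotient (fun g => act g) p) :
    Surjective p.left := by
  haveI : IsProper X.hom := hX.isProper
  haveI : IsSeparated X.hom := inferInstance
  let ρ : ActionOver X.hom Δ := ⟨((Over.forget _).mapAut X).comp act, fun g => Over.w (act g).hom⟩
  have hcov := ActionOver.forall_exists_stableAffineOpen_of_isProjectiveOver ρ hX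
  obtain ⟨i, hi⟩ : ∃ i : Y ≅ finiteQuotient ρ, p ≫ i.hom = finiteQuotient.mk ρ hcov :=
    isoFiniteQuotient_of_isSepQuotient' hX act p hY' hq
  haveI : IsIso i.inv.left := by
    change IsIso ((Over.forget _).map i.inv)
    infer_instance
  haveI : Surjective (finiteQuotient.mk ρ hcov).left := ⟨finiteQuotient.mk_left_surjective ρ hcov⟩
  have hp : p = finiteQuotient.mk ρ hcov ≫ i.inv := (Iso.eq_comp_inv i).mpr hi
  rw [hp, Over.comp_left]
  infer_instance

end Literature.AlgebraicGeometry.Motives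

end
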